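import Mathlib
import Literature.NumberTheory.Transcendental.BlochWignerDilogarithm
import HarnessLib

/-!
# The Bloch–Wigner dilogarithm vanishes on `ℝ` (proofs companion of `BlochWignerDilogarithm.lean`)

Topic `Literature/NumberTheory/Transcendental`. Theorems only (no new definitions or facts):

* `im_dilog_ofReal_of_one_lt` — for real `x > 1`, `Im (dilog x) = −π log x`: with Mathlib's
  principal `log`/`arg` (`arg` of a negative real is `π`) the tree's `dilog` takes on the cut
  `(1, ∞)` the boundary value from below, `Li₂(x − i0) = Re Li₂(x) − iπ log x` (the jump of `Li₂`
  across its cut is `2πi log x`; Zagier 2007, Ch. I §1; here a direct computation);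
* `blochWignerDilog_ofReal` — **`D(x) = 0` for every real `x`** (for `x ≤ 1`: `Li₂(x)` real and
  `arg(1 − x) = 0`, already in the definitions file; for `x > 1`: `−π log x + π·log x = 0`), so the
  tree's `blochWignerDilog` agrees with the (continuous) Bloch–Wigner function on the whole real
  line, where it vanishes (a flat ideal tetrahedron has volume `0`; Neumann 1998, §2, p. 6);
* `blochWignerDilog_of_im_eq_zero`, and `blochWignerDilog_conj'` — **`D(z̄) = −D(z)` for all
  `z ∈ ℂ`** (Neumann 1998, Thm. 2.4: `[z] = −[z̄]`), removing the hypothesis `Im z ≠ 0` of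
  `blochWignerDilog_conj`.

The analytic input is the interval-integrability on `[0, 1]` of the integrand
`s ↦ log(1 − xs)/s` of `Li₂(x)` for `x > 1`: near `s = 0` it is bounded by `2x`
(`|log(1 − u)| ≤ u/(1 − u)` for `0 ≤ u < 1`), and on `[1/(2x), 1]` it is `log(1 − xs)` (real part
`log|1 − xs|`, interval-integrable by `intervalIntegrable_log'` composed with an affine map;
imaginary part `arg(1 − xs)`, bounded and measurable) times the continuous `1/s`. Then
`Im ∫ = ∫ Im`, and `∫₀¹ arg(1 − xs) ds/s = ∫_{1/x}^1 π ds/s = π log x`.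

## References

* W. D. Neumann, *Hilbert's 3rd problem and invariants of 3-manifolds*, Geom. Topol. Monogr. 1
  (1998), arXiv:math/9712226: §2, p. 6 (flat simplices), Thm. 2.4. [`Neumann1998`]
* D. Zagier, *The dilogarithm function* (2007), Ch. I §§1, 3. [`Zagier2007Dilogarithm`]
-/

noncomputable section

open MeasureTheory intervalIntegral
open scoped ComplexConjugate

namespace Literature.NumberTheory.Transcendental

/-! ### Integrability of the integrand of `Li₂(x)`, `x > 1` real -/

section RealAxis

variable {x : ℝ}

/-- `1 - x·s` as the cast of a real number. [folklore] -/
private theorem cast_one_sub_mul (x s : ℝ) : (1 - (x : ℂ) * (s : ℂ)) = ((1 - x * s : ℝ) : ℂ) := by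
  push_cast; ring

/-- `s ↦ log(1 − xs)` (real) is interval-integrable on every interval. [folklore] -/
private theorem intervalIntegrable_log_one_sub_mul (hx : x ≠ 0) (A B : ℝ) :
    IntervalIntegrable (fun s : ℝ => Real.log (1 - x * s)) volume A B := by
  have h1 : IntervalIntegrable (fun u : ℝ => Real.log (1 - u)) volume (x * A) (x * B) := by
    simpa using
      (intervalIntegral.intervalIntegrable_log' (a := 1 - x * A) (b := 1 - x * B)).comp_sub_left 1
  simpa [mul_div_cancel_left₀ _ hx] using h1.comp_mul_left (c := x)

/-- `s ↦ arg(1 − xs)` (bounded by `π`, measurable) is interval-integrable as a complex-valued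
function. [folklore] -/
private theorem intervalIntegrable_arg_one_sub_mul (x A B : ℝ) :
    IntervalIntegrable (fun s : ℝ => ((Complex.arg (1 - (x : ℂ) * (s : ℂ)) : ℝ) : ℂ))
      volume A B := by
  refine IntervalIntegrable.mono_fun' (g := fun _ => Real.pi) intervalIntegrable_const ?_ ?_
  · have hm : Measurable fun s : ℝ => ((Complex.arg (1 - (x : ℂ) * (s : ℂ)) : ℝ) : ℂ) :=
      Complex.measurable_ofReal.comp (Complex.measurable_arg.comp (by fun_prop))
    exact hm.aestronglyMeasurable
  · refine Filter.Eventually.of_forall fun s => ?_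
    simp only [Complex.norm_real, Real.norm_eq_abs]
    exact Complex.abs_arg_le_pi _

/-- `s ↦ log(1 − xs)` (complex, principal branch) is interval-integrable on every interval:
real part `log|1 − xs|`, imaginary part `arg(1 − xs)`. [folklore] -/
private theorem intervalIntegrable_clog_one_sub_mul (hx : x ≠ 0) (A B : ℝ) :
    IntervalIntegrable (fun s : ℝ => Complex.log (1 - (x : ℂ) * (s : ℂ))) volume A B := by
  have hdecomp : (fun s : ℝ => Complex.log (1 - (x : ℂ) * (s : ℂ))) = fun s =>
      ((Real.log (1 - x * s) : ℝ) : ℂ) +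
        ((Complex.arg (1 - (x : ℂ) * (s : ℂ)) : ℝ) : ℂ) * Complex.I := by
    funext s
    apply Complex.ext
    · rw [Complex.log_re, cast_one_sub_mul, Complex.norm_real, Real.norm_eq_abs, Real.log_abs]
      simp
    · rw [Complex.log_im]
      simp
  rw [hdecomp]
  have hlog := intervalIntegrable_log_one_sub_mul hx A B
  have hlogC : IntervalIntegrable (fun s : ℝ => ((Real.log (1 - x * s) : ℝ) : ℂ)) volume A B :=
    ⟨hlog.1.ofReal, hlog.2.ofReal⟩
  exact hlogC.add ((intervalIntegrable_arg_one_sub_mul x A B).mul_const Complex.I)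

/-- Near `s = 0` the integrand of `Li₂(x)` is bounded: for `x > 1` and `0 < s ≤ 1/(2x)`,
`|log(1 − xs)|/s ≤ 2x`. [folklore] -/
private theorem norm_log_div_le (hx : 1 < x) {s : ℝ} (hs0 : 0 < s) (hs1 : s ≤ 1 / (2 * x)) :
    ‖Complex.log (1 - (x : ℂ) * (s : ℂ)) / (s : ℂ)‖ ≤ 2 * x := by
  have hx0 : 0 < x := by linarith
  have hxs : x * s ≤ 1 / 2 := by
    calc x * s ≤ x * (1 / (2 * x)) := by gcongr
      _ = 1 / 2 := by field_simp
  have hxs0 : 0 ≤ x * s := by positivity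
  have hpos : 0 < 1 - x * s := by linarith
  have hcast : Complex.log (1 - (x : ℂ) * (s : ℂ)) / (s : ℂ) =
      ((Real.log (1 - x * s) / s : ℝ) : ℂ) := by
    rw [Complex.ofReal_div, Complex.ofReal_log hpos.le, cast_one_sub_mul]
  rw [hcast, Complex.norm_real, Real.norm_eq_abs, abs_div, abs_of_pos hs0]
  have hlog_nonpos : Real.log (1 - x * s) ≤ 0 := Real.log_nonpos hpos.le (by linarith)
  have hlog_lb : -Real.log (1 - x * s) ≤ x * s / (1 - x * s) := by
    have h := Real.one_sub_inv_le_log_of_pos hpos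
    have h' : (1 - x * s)⁻¹ - 1 = x * s / (1 - x * s) := by
      field_simp
      ring
    linarith
  rw [abs_of_nonpos hlog_nonpos, div_le_iff₀ hs0]
  calc -Real.log (1 - x * s) ≤ x * s / (1 - x * s) := hlog_lb
    _ ≤ x * s / (1 / 2) := by gcongr; linarith
    _ = 2 * x * s := by ring

/-- The integrand of `Li₂(x)`, `x > 1`, is interval-integrable on `[0, 1]`. [folklore] -/
private theorem intervalIntegrable_dilogIntegrand (hx : 1 < x) :
    IntervalIntegrable (fun s : ℝ => Complex.log (1 - (x : ℂ) * (s : ℂ)) / (s : ℂ)) volume 0 1 := by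
  have hx0 : 0 < x := by linarith
  have hm : 0 < 1 / (2 * x) := by positivity
  -- near `0`: bounded by `2x`
  have hleft : IntervalIntegrable (fun s : ℝ => Complex.log (1 - (x : ℂ) * (s : ℂ)) / (s : ℂ))
      volume 0 (1 / (2 * x)) := by
    refine IntervalIntegrable.mono_fun' (g := fun _ => 2 * x) intervalIntegrable_const ?_ ?_
    · have hmeas : Measurable fun s : ℝ => Complex.log (1 - (x : ℂ) * (s : ℂ)) / (s : ℂ) :=
        (Complex.measurable_log.comp (by fun_prop)).div (by fun_prop)
      exact hmeas.aestronglyMeasurable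
    · rw [Set.uIoc_of_le hm.le, Filter.EventuallyLE, ae_restrict_iff' measurableSet_Ioc]
      exact Filter.Eventually.of_forall fun s hs => norm_log_div_le hx hs.1 hs.2
  -- away from `0`: `log(1 − xs)` integrable times `1/s` continuous
  have hright : IntervalIntegrable (fun s : ℝ => Complex.log (1 - (x : ℂ) * (s : ℂ)) / (s : ℂ))
      volume (1 / (2 * x)) 1 := by
    have hcont : ContinuousOn (fun s : ℝ => (1 : ℂ) / (s : ℂ)) (Set.uIcc (1 / (2 * x)) 1) := by
      refine continuousOn_const.div Complex.continuous_ofReal.continuousOn fun s hs => ?_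
      have hx1 : 1 / (2 * x) ≤ 1 := by
        rw [div_le_one (by positivity)]; linarith
      rw [Set.uIcc_of_le hx1] at hs
      exact Complex.ofReal_ne_zero.2 (by linarith [hs.1] : s ≠ 0)
    have h := (intervalIntegrable_clog_one_sub_mul hx0.ne' (1 / (2 * x)) 1).mul_continuousOn hcont
    simpa [div_eq_mul_inv] using h
  exact hleft.trans hright

/-- **`Im Li₂(x − i0) = −π log x` for `x > 1`** (the value of `dilog` on the cut).
[folklore] -/
theorem im_dilog_ofReal_of_one_lt (hx : 1 < x) :
    (dilog (x : ℂ)).im = -(Real.pi * Real.log x) := by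
  have hx0 : 0 < x := by linarith
  have hx1 : 1 / x ≤ 1 := by rw [div_le_one hx0]; exact hx.le
  have hxinv : 0 < 1 / x := by positivity
  have hF := intervalIntegrable_dilogIntegrand hx
  -- `Im ∫ F = ∫ Im F`
  have him : (∫ s in (0 : ℝ)..1, Complex.log (1 - (x : ℂ) * (s : ℂ)) / (s : ℂ)).im =
      ∫ s in (0 : ℝ)..1, Complex.arg (1 - (x : ℂ) * (s : ℂ)) / s := by
    rw [intervalIntegral.integral_of_le zero_le_one, intervalIntegral.integral_of_le zero_le_one,
      ← RCLike.im_to_complex, ← integral_im hF.1]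
    refine integral_congr_ae (Filter.Eventually.of_forall fun s => ?_)
    simp [Complex.log_im]
  -- the imaginary part of the integrand: `0` on `[0, 1/x]`, `π/s` on `(1/x, 1]`
  have hzero : ∫ s in (0 : ℝ)..(1 / x), Complex.arg (1 - (x : ℂ) * (s : ℂ)) / s = 0 := by
    rw [intervalIntegral.integral_congr (g := fun _ => (0 : ℝ)) ?_, intervalIntegral.integral_zero]
    intro s hs
    rw [Set.uIcc_of_le hxinv.le] at hs
    have hxs : x * s ≤ 1 := by
      calc x * s ≤ x * (1 / x) := by gcongr; exact hs.2
        _ = 1 := by field_simp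
    simp only
    rw [cast_one_sub_mul, Complex.arg_ofReal_of_nonneg (by linarith), zero_div]
  have hpi_int : IntervalIntegrable (fun s : ℝ => Real.pi * s⁻¹) volume (1 / x) 1 := by
    refine ContinuousOn.intervalIntegrable (continuousOn_of_forall_continuousAt fun s hs => ?_)
    rw [Set.uIcc_of_le hx1] at hs
    have hs0 : s ≠ 0 := by linarith [hs.1]
    fun_prop (disch := exact hs0)
  have hae : ∀ᵐ s : ℝ, s ∈ Set.uIoc (1 / x) 1 →
      Real.pi * s⁻¹ = Complex.arg (1 - (x : ℂ) * (s : ℂ)) / s := by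
    refine Filter.Eventually.of_forall fun s hs => ?_
    rw [Set.uIoc_of_le hx1] at hs
    have hxs : 1 < x * s := by
      calc (1 : ℝ) = x * (1 / x) := by field_simp
        _ < x * s := by gcongr; exact hs.1
    rw [cast_one_sub_mul, Complex.arg_ofReal_of_neg (by linarith), div_eq_mul_inv]
  have hpi : ∫ s in (1 / x : ℝ)..1, Complex.arg (1 - (x : ℂ) * (s : ℂ)) / s =
      Real.pi * Real.log x := by
    rw [← intervalIntegral.integral_congr_ae hae, intervalIntegral.integral_const_mul,
      integral_inv (by rw [Set.uIcc_of_le hx1]; exact fun h => by linarith [h.1])]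
    simp
  have hzero_int : IntervalIntegrable (fun s : ℝ => Complex.arg (1 - (x : ℂ) * (s : ℂ)) / s)
      volume 0 (1 / x) := by
    refine (intervalIntegrable_const (c := (0 : ℝ))).congr_ae ?_
    rw [Filter.EventuallyEq, ae_restrict_iff' measurableSet_uIoc]
    refine Filter.Eventually.of_forall fun s hs => ?_
    rw [Set.uIoc_of_le hxinv.le] at hs
    have hxs : x * s ≤ 1 := by
      calc x * s ≤ x * (1 / x) := by gcongr; exact hs.2
        _ = 1 := by field_simp
    rw [cast_one_sub_mul, Complex.arg_ofReal_of_nonneg (by linarith), zero_div]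
  have hpi_int' : IntervalIntegrable (fun s : ℝ => Complex.arg (1 - (x : ℂ) * (s : ℂ)) / s)
      volume (1 / x) 1 :=
    hpi_int.congr_ae ((ae_restrict_iff' measurableSet_uIoc).2 hae)
  rw [dilog, Complex.neg_im, him,
    ← intervalIntegral.integral_add_adjacent_intervals hzero_int hpi_int', hzero, hpi, zero_add]

/-- **`D` vanishes on `ℝ`**: `D(x) = 0` for every real `x` (for `x ≤ 1` because `Li₂(x)` is real
and `arg(1 − x) = 0`; for `x > 1` because `Im Li₂(x − i0) = −π log x` cancels
`arg(1 − x) log x = π log x`). [folklore] -/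
theorem blochWignerDilog_ofReal (x : ℝ) : blochWignerDilog (x : ℂ) = 0 := by
  rcases le_or_gt x 1 with hx | hx
  · exact blochWignerDilog_ofReal_of_le_one hx
  · have harg : Complex.arg (1 - (x : ℂ)) = Real.pi := by
      have : (1 - (x : ℂ)) = ((1 - x : ℝ) : ℂ) := by push_cast; ring
      rw [this, Complex.arg_ofReal_of_neg (by linarith)]
    rw [blochWignerDilog, im_dilog_ofReal_of_one_lt hx, harg, Complex.norm_real, Real.norm_eq_abs,
      abs_of_pos (by linarith)]
    ring

/-- `D(z) = 0` whenever `Im z = 0`. [folklore] -/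
theorem blochWignerDilog_of_im_eq_zero {z : ℂ} (hz : z.im = 0) : blochWignerDilog z = 0 := by
  have : z = ((z.re : ℝ) : ℂ) := by
    apply Complex.ext <;> simp [hz]
  rw [this]
  exact blochWignerDilog_ofReal z.re

/-- **`D(z̄) = −D(z)` for every `z ∈ ℂ`** (off `ℝ` by `blochWignerDilog_conj`; on `ℝ` both sides
vanish). [cite: Neumann1998, §2, Thm. 2.4 and p. 7] -/
theorem blochWignerDilog_conj' (z : ℂ) : blochWignerDilog (conj z) = -blochWignerDilog z := by
  rcases eq_or_ne z.im 0 with hz | hz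
  · rw [blochWignerDilog_of_im_eq_zero hz, blochWignerDilog_of_im_eq_zero (by simp [hz]), neg_zero]
  · exact blochWignerDilog_conj hz

end RealAxis

end Literature.NumberTheory.Transcendental

end
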